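import Summits.Ventures.PercRepro2.CaseOnePendantAny
import Summits.Ventures.PercRepro2.CaseOnePendantAnyI

/-!
# Deleting a leaf edge: the case-1 quantities at the other vertices are unchanged
(blind cell PercRepro2, p1 g16; S5 §2.1 (K9) (q), the pendant-at-marked-star class)

The cell's structural class predicates (`IsMarkedStarAt`, `IsTwoMarkAt`, …) say that a vertex has
*exactly* the listed edges, so a theorem proved for a vertex `u` cannot be applied in a graph where `u`
carries one more edge — even a pendant edge `e₀ = {u, a₃}` to a leaf `a₃`, which no connection among the
other vertices ever uses. This file supplies the transfer: the edge type `{e // e ≠ e₀}` with the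
restricted ends and weights is "`G − e₀`", the restriction `restrictCfg e₀ : Config E → Config {e // e ≠ e₀}`
pushes the product law forward (`expect_restrict`, `prob_restrict` — the factor of the deleted edge sums
to `1`, so the weight of `e₀` is irrelevant), and for a leaf `a₃ ∉ {x, y}` the connection `x ↔ y` is the
same in `G` and in `G − e₀` (`conn_restrict_iff_of_leaf`, from `conn_iff_update_of_leaf`). Hence every
probability of an event among the other vertices, and so `Dpd`, `Dpdo`, `Dqo`, `iiExpr`, `iExpr` and
`iiExprT` at a vertex `v ≠ a₃`, agree (`iiExpr_restrict`, `iExpr_restrict`, `iiExprT_restrict`, …), and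
the Props `ZSplitII`, `ZSplitIIQ`, `ZSplitI`, `ZSplitIQ` at `v` transfer from `G − e₀` to `G`. -/

namespace Summit.Ventures.PercRepro2

namespace CaseOne

/-! ## The restriction to `E ∖ {e₀}` and the push-forward of the product law -/

section Restrict
variable {V : Type*} {E : Type*} [Fintype E] [DecidableEq E] {R : Type*} [CommRing R]

/-- The configuration restricted to the edges other than `e₀`. -/
def restrictCfg (e₀ : E) (ω : Config E) : Config {e : E // e ≠ e₀} := fun e => ω e.1

/-- The weights restricted to the edges other than `e₀`. -/
def restrictW (p : E → R) (e₀ : E) : {e : E // e ≠ e₀} → R := fun e => p e.1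

/-- The ends restricted to the edges other than `e₀` (the graph `G − e₀`). -/
def restrictEnds (ends : E → Sym2 V) (e₀ : E) : {e : E // e ≠ e₀} → Sym2 V := fun e => ends e.1

omit [Fintype E] in
/-- Restricting ignores an update at `e₀`. -/
@[simp] lemma restrictCfg_update (e₀ : E) (ω : Config E) (c : Bool) :
    restrictCfg e₀ (Function.update ω e₀ c) = restrictCfg e₀ ω := by
  funext e
  simp [restrictCfg, Function.update_of_ne e.2]

/-- The configurations of `E` are the pairs (configuration of `E ∖ {e₀}`, state of `e₀`). -/
def cfgEquiv (e₀ : E) : Config E ≃ Config {e : E // e ≠ e₀} × Bool where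
  toFun ω := (restrictCfg e₀ ω, ω e₀)
  invFun x := fun e => if h : e = e₀ then x.2 else x.1 ⟨e, h⟩
  left_inv ω := by
    funext e
    by_cases h : e = e₀
    · subst h; simp
    · simp [restrictCfg, h]
  right_inv x := by
    obtain ⟨ω', c⟩ := x
    refine Prod.ext ?_ ?_
    · funext e
      simp [restrictCfg, e.2]
    · simp

omit [Fintype E] in
/-- The restriction of the configuration assembled from `(ω', c)` is `ω'`. -/
lemma restrictCfg_cfgEquiv_symm (e₀ : E) (ω' : Config {e : E // e ≠ e₀}) (c : Bool) :
    restrictCfg e₀ ((cfgEquiv e₀).symm (ω', c)) = ω' := by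
  funext e
  simp [cfgEquiv, restrictCfg, e.2]

omit [Fintype E] in
/-- The configuration assembled from `(ω', c)` has state `c` at `e₀`. -/
lemma cfgEquiv_symm_apply_self (e₀ : E) (ω' : Config {e : E // e ≠ e₀}) (c : Bool) :
    (cfgEquiv e₀).symm (ω', c) e₀ = c := by
  simp [cfgEquiv]

/-- The weight splits off the factor of `e₀`. -/
lemma weight_restrict (p : E → R) (e₀ : E) (ω : Config E) :
    weight p ω = weight (restrictW p e₀) (restrictCfg e₀ ω) * edgeFactor (p e₀) (ω e₀) := by
  unfold weight
  rw [← Finset.prod_erase_mul _ _ (Finset.mem_univ e₀)]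
  congr 1
  rw [Finset.prod_subtype (Finset.univ.erase e₀) (p := fun e => e ≠ e₀)
    (fun e => by simp [Finset.mem_erase])]
  rfl

/-- **Push-forward of the product law**: the expectation of a function of the restricted
configuration is its expectation under the restricted weights (the factor of `e₀` sums to `1`). -/
theorem expect_restrict (p : E → R) (e₀ : E) (f : Config {e : E // e ≠ e₀} → R) :
    expect p (fun ω => f (restrictCfg e₀ ω)) = expect (restrictW p e₀) f := by
  unfold expect
  rw [← (cfgEquiv e₀).symm.sum_comp, Fintype.sum_prod_type]
  simp only [weight_restrict p e₀, restrictCfg_cfgEquiv_symm, cfgEquiv_symm_apply_self,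
    Fintype.sum_bool]
  refine Finset.sum_congr rfl fun ω' _ => ?_
  have := edgeFactor_true_add_false (p e₀)
  linear_combination (weight (restrictW p e₀) ω' * f ω') * this

/-- Push-forward of the product law for events. -/
theorem prob_restrict (p : E → R) (e₀ : E) (A : Set (Config {e : E // e ≠ e₀})) :
    prob p (restrictCfg e₀ ⁻¹' A) = prob (restrictW p e₀) A := by
  rw [prob_eq_expect_indicator, prob_eq_expect_indicator, ← expect_restrict]
  rfl

omit [Fintype E] [DecidableEq E] in
/-- The restricted weights of a probability vector form a probability vector. -/
lemma IsProbVec.restrictW [LinearOrder R] [IsStrictOrderedRing R] {p : E → R} (hp : IsProbVec p)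
    (e₀ : E) : IsProbVec (restrictW p e₀) :=
  ⟨fun e => hp.nonneg e.1, fun e => hp.le_one e.1⟩

end Restrict

/-! ## Connections across a deleted leaf edge -/

section Leaf
variable {V : Type*} {E : Type*} [DecidableEq E] {ends : E → Sym2 V} {u a₃ : V} {e₀ : E}

omit [DecidableEq E] in
/-- With `e₀` closed, open adjacency is the same in `G` and in `G − e₀`. -/
lemma openAdj_restrict_iff {ω : Config E} (hω : ω e₀ = false) {x y : V} :
    OpenAdj ends ω x y ↔ OpenAdj (restrictEnds ends e₀) (restrictCfg e₀ ω) x y := by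
  constructor
  · rintro ⟨e, he, hends⟩
    have hne : e ≠ e₀ := by
      rintro rfl
      rw [hω] at he
      exact Bool.false_ne_true he
    exact ⟨⟨e, hne⟩, he, hends⟩
  · rintro ⟨⟨e, _⟩, he, hends⟩
    exact ⟨e, he, hends⟩

omit [DecidableEq E] in
/-- With `e₀` closed, the open subgraphs of `G` and `G − e₀` coincide. -/
lemma openGraph_restrict {ω : Config E} (hω : ω e₀ = false) :
    openGraph ends ω = openGraph (restrictEnds ends e₀) (restrictCfg e₀ ω) := by
  ext x y
  rw [openGraph_adj, openGraph_adj, openAdj_restrict_iff hω]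

omit [DecidableEq E] in
/-- With `e₀` closed, connections are the same in `G` and in `G − e₀`. -/
lemma conn_restrict_iff_of_closed {ω : Config E} (hω : ω e₀ = false) {x y : V} :
    Conn ends ω x y ↔ Conn (restrictEnds ends e₀) (restrictCfg e₀ ω) x y := by
  unfold Conn
  rw [openGraph_restrict hω]

/-- **Deleting a leaf edge**: for a leaf `a₃` at `u` and `x, y ≠ a₃`, `x ↔ y` in `G` iff in `G − e₀`. -/
theorem conn_restrict_iff_of_leaf (hl : IsLeafAt ends u a₃ e₀) (ω : Config E) {x y : V}
    (hx : x ≠ a₃) (hy : y ≠ a₃) :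
    Conn ends ω x y ↔ Conn (restrictEnds ends e₀) (restrictCfg e₀ ω) x y := by
  rw [conn_iff_update_of_leaf hl ω hx hy,
    conn_restrict_iff_of_closed (ω := Function.update ω e₀ false) (Function.update_self e₀ false ω),
    restrictCfg_update]

/-- The connection event among non-leaf vertices is the preimage of the event in `G − e₀`. -/
theorem connEvent_restrict (hl : IsLeafAt ends u a₃ e₀) {x y : V} (hx : x ≠ a₃) (hy : y ≠ a₃) :
    connEvent ends x y = restrictCfg e₀ ⁻¹' connEvent (restrictEnds ends e₀) x y := by
  ext ω
  simp only [mem_connEvent, Set.mem_preimage]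
  exact conn_restrict_iff_of_leaf hl ω hx hy

end Leaf

/-! ## The case-1 quantities at a vertex `v ≠ a₃` -/

section Transfer
variable {V : Type*} {E : Type*} [Fintype E] [DecidableEq E] {R : Type*} [CommRing R]
variable {ends : E → Sym2 V} {o a₁ a₂ v b u a₃ : V} {e₀ : E}

/-- `D` at `v` is unchanged by deleting a leaf edge elsewhere. -/
theorem Dpd_restrict (p : E → R) (hl : IsLeafAt ends u a₃ e₀) (h1 : a₁ ≠ a₃) (h2 : a₂ ≠ a₃)
    (hv : v ≠ a₃) :
    Dpd p ends a₁ a₂ v = Dpd (restrictW p e₀) (restrictEnds ends e₀) a₁ a₂ v := by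
  unfold Dpd
  rw [connEvent_restrict hl h1 hv, connEvent_restrict hl h2 hv, connEvent_restrict hl h1 h2]
  simp only [← Set.preimage_compl, ← Set.preimage_inter, prob_restrict]

/-- `D_o` at `v` is unchanged by deleting a leaf edge elsewhere. -/
theorem Dpdo_restrict (p : E → R) (hl : IsLeafAt ends u a₃ e₀) (ho : o ≠ a₃) (h1 : a₁ ≠ a₃)
    (h2 : a₂ ≠ a₃) (hv : v ≠ a₃) :
    Dpdo p ends o a₁ a₂ v = Dpdo (restrictW p e₀) (restrictEnds ends e₀) o a₁ a₂ v := by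
  unfold Dpdo
  rw [connEvent_restrict hl h1 ho, connEvent_restrict hl h2 ho, connEvent_restrict hl h1 hv,
    connEvent_restrict hl h2 hv, connEvent_restrict hl h1 h2]
  simp only [← Set.preimage_compl, ← Set.preimage_inter, ← Set.preimage_union, prob_restrict]

/-- `P(Q, o ∈ U)` is unchanged by deleting a leaf edge elsewhere. -/
theorem Dqo_restrict (p : E → R) (hl : IsLeafAt ends u a₃ e₀) (ho : o ≠ a₃) (h1 : a₁ ≠ a₃)
    (h2 : a₂ ≠ a₃) :
    Dqo p ends o a₁ a₂ = Dqo (restrictW p e₀) (restrictEnds ends e₀) o a₁ a₂ := by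
  unfold Dqo
  rw [connEvent_restrict hl h1 ho, connEvent_restrict hl h2 ho, connEvent_restrict hl h1 h2]
  simp only [← Set.preimage_compl, ← Set.preimage_inter, ← Set.preimage_union, prob_restrict]

/-- `P(Q)` is unchanged by deleting a leaf edge elsewhere. -/
theorem probQ_restrict (p : E → R) (hl : IsLeafAt ends u a₃ e₀) (h1 : a₁ ≠ a₃) (h2 : a₂ ≠ a₃) :
    prob p (connEvent ends a₁ a₂)ᶜ =
      prob (restrictW p e₀) (connEvent (restrictEnds ends e₀) a₁ a₂)ᶜ := by
  rw [connEvent_restrict hl h1 h2, ← Set.preimage_compl, prob_restrict]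

/-- **`iiExpr` at `v` is unchanged by deleting a leaf edge elsewhere.** -/
theorem iiExpr_restrict (p : E → R) (hl : IsLeafAt ends u a₃ e₀) (ho : o ≠ a₃) (h1 : a₁ ≠ a₃)
    (h2 : a₂ ≠ a₃) (hv : v ≠ a₃) (hb : b ≠ a₃) :
    iiExpr p ends o a₁ a₂ v b = iiExpr (restrictW p e₀) (restrictEnds ends e₀) o a₁ a₂ v b := by
  rw [iiExpr_eq_probs, iiExpr_eq_probs, Dpd_restrict p hl h1 h2 hv, Dpdo_restrict p hl ho h1 h2 hv]
  rw [connEvent_restrict hl h2 hb, connEvent_restrict hl h1 hv, connEvent_restrict hl h2 ho,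
    connEvent_restrict hl h1 h2]
  simp only [← Set.preimage_compl, ← Set.preimage_inter, prob_restrict]

/-- **`iExpr` at `v` is unchanged by deleting a leaf edge elsewhere.** -/
theorem iExpr_restrict (p : E → R) (hl : IsLeafAt ends u a₃ e₀) (ho : o ≠ a₃) (h1 : a₁ ≠ a₃)
    (h2 : a₂ ≠ a₃) (hv : v ≠ a₃) (hb : b ≠ a₃) :
    iExpr p ends o a₁ a₂ v b = iExpr (restrictW p e₀) (restrictEnds ends e₀) o a₁ a₂ v b := by
  rw [iExpr_eq_iExprT, iExpr_eq_iExprT, iExprT_eq, iExprT_eq, Dpd_restrict p hl h1 h2 hv,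
    Dpdo_restrict p hl ho h1 h2 hv]
  rw [connEvent_restrict hl h1 hb, connEvent_restrict hl h1 hv, connEvent_restrict hl h2 ho,
    connEvent_restrict hl h1 h2]
  simp only [← Set.preimage_compl, ← Set.preimage_inter, prob_restrict]

/-- **`iiExprT` at `v` is unchanged by deleting a leaf edge elsewhere** (any threshold pair). -/
theorem iiExprT_restrict (p : E → R) (hl : IsLeafAt ends u a₃ e₀) (ho : o ≠ a₃) (h1 : a₁ ≠ a₃)
    (h2 : a₂ ≠ a₃) (hv : v ≠ a₃) (hb : b ≠ a₃) (c₀ c₁ : R) :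
    iiExprT p ends o a₁ a₂ v b c₀ c₁ =
      iiExprT (restrictW p e₀) (restrictEnds ends e₀) o a₁ a₂ v b c₀ c₁ := by
  rw [iiExprT_eq, iiExprT_eq]
  rw [connEvent_restrict hl h2 hb, connEvent_restrict hl h1 hv, connEvent_restrict hl h2 ho,
    connEvent_restrict hl h1 h2]
  simp only [← Set.preimage_compl, ← Set.preimage_inter, prob_restrict]

/-- **`iExprT` at `v` is unchanged by deleting a leaf edge elsewhere** (any threshold pair). -/
theorem iExprT_restrict (p : E → R) (hl : IsLeafAt ends u a₃ e₀) (ho : o ≠ a₃) (h1 : a₁ ≠ a₃)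
    (h2 : a₂ ≠ a₃) (hv : v ≠ a₃) (hb : b ≠ a₃) (c₀ c₁ : R) :
    iExprT p ends o a₁ a₂ v b c₀ c₁ =
      iExprT (restrictW p e₀) (restrictEnds ends e₀) o a₁ a₂ v b c₀ c₁ := by
  rw [iExprT_eq, iExprT_eq]
  rw [connEvent_restrict hl h1 hb, connEvent_restrict hl h1 hv, connEvent_restrict hl h2 ho,
    connEvent_restrict hl h1 h2]
  simp only [← Set.preimage_compl, ← Set.preimage_inter, prob_restrict]

end Transfer

/-! ## The Props transfer -/

section Props
variable {V : Type*} {E : Type*} [Fintype E] [DecidableEq E] {R : Type*} [CommRing R] [LinearOrder R]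
variable {ends : E → Sym2 V} {o a₁ a₂ v b u a₃ : V} {e₀ : E}

/-- `(ii)` at `v` in `G − e₀` gives `(ii)` at `v` in `G`. -/
theorem zSplitII_of_restrict (p : E → R) (hl : IsLeafAt ends u a₃ e₀) (ho : o ≠ a₃) (h1 : a₁ ≠ a₃)
    (h2 : a₂ ≠ a₃) (hv : v ≠ a₃) (hb : b ≠ a₃)
    (h : ZSplitII (restrictW p e₀) (restrictEnds ends e₀) o a₁ a₂ v b) :
    ZSplitII p ends o a₁ a₂ v b := by
  unfold ZSplitII at h ⊢
  rw [iiExpr_restrict p hl ho h1 h2 hv hb]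
  exact h

/-- `(i)` at `v` in `G − e₀` gives `(i)` at `v` in `G`. -/
theorem zSplitI_of_restrict (p : E → R) (hl : IsLeafAt ends u a₃ e₀) (ho : o ≠ a₃) (h1 : a₁ ≠ a₃)
    (h2 : a₂ ≠ a₃) (hv : v ≠ a₃) (hb : b ≠ a₃)
    (h : ZSplitI (restrictW p e₀) (restrictEnds ends e₀) o a₁ a₂ v b) :
    ZSplitI p ends o a₁ a₂ v b := by
  unfold ZSplitI at h ⊢
  rw [iExpr_restrict p hl ho h1 h2 hv hb]
  exact h

/-- `(ii-Q)` at `v` in `G − e₀` gives `(ii-Q)` at `v` in `G`. -/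
theorem zSplitIIQ_of_restrict (p : E → R) (hl : IsLeafAt ends u a₃ e₀) (ho : o ≠ a₃) (h1 : a₁ ≠ a₃)
    (h2 : a₂ ≠ a₃) (hv : v ≠ a₃) (hb : b ≠ a₃)
    (h : ZSplitIIQ (restrictW p e₀) (restrictEnds ends e₀) o a₁ a₂ v b) :
    ZSplitIIQ p ends o a₁ a₂ v b := by
  unfold ZSplitIIQ at h ⊢
  rw [iiExprT_restrict p hl ho h1 h2 hv hb, Dqo_restrict p hl ho h1 h2, probQ_restrict p hl h1 h2]
  exact h

/-- `(i-Q)` at `v` in `G − e₀` gives `(i-Q)` at `v` in `G`. -/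
theorem zSplitIQ_of_restrict (p : E → R) (hl : IsLeafAt ends u a₃ e₀) (ho : o ≠ a₃) (h1 : a₁ ≠ a₃)
    (h2 : a₂ ≠ a₃) (hv : v ≠ a₃) (hb : b ≠ a₃)
    (h : ZSplitIQ (restrictW p e₀) (restrictEnds ends e₀) o a₁ a₂ v b) :
    ZSplitIQ p ends o a₁ a₂ v b := by
  unfold ZSplitIQ at h ⊢
  rw [iExprT_restrict p hl ho h1 h2 hv hb, Dqo_restrict p hl ho h1 h2, probQ_restrict p hl h1 h2]
  exact h

end Props

end CaseOne

end Summit.Ventures.PercRepro2
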